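import Summits.QuantumFields.YangMills.Theorems.BalabanUVNodesN11TkOpMeasurable

/-!
# DAG node N11 — THE SKEW-PRODUCT CHAIN RULE FOR def-T's KERNEL TRANSPORT (the (S-α) ∕ (B4) SEPARATION FACE, generic half)

HEADER — WORK-UNIT METADATA.  Cell `pub-ymgap`, YM-PLAN Track A (HUMAN RULING D-0062 ∕ D-0149), WIDTH SEAT `pub-ymgap-dag-n11-w2` (g3) on node
N11 [B14]; route `BalabanUVNodes`, key item K1⁷ `StabilityBAtRecordR13SepCoPH` = stmt-QuantumFields-20542 (helper, `--kind proof --supports 20542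
--as helper`, count-neutral).  [I] = [Balaban1987RG1], [III] = [Balaban1988Convergent].  Bus: CLAIM-1 = INTENT-1 of this seat (R455 (A)); the
SHAPE is dag-n11-e g20's ANSWER ∕ REFINEMENT to dag-n11-d g14's `…N11KernelTransportInFibreChart` (the kernel-free fibre-chart SOCKET `hpush` + `hfib`
⇒ `kernelTransport … =ᵐ fibre integral`): «the CHAIN RULE FOR DISINTEGRATIONS of a SKEW product: `ν = ν_out ⊗ ν_in`, `μ = μ_out ⊗ μ_rest`,
`avg U = (avg_out U_out, avg_rest (U_out, U_in))` with `avg_out` reading `U_out` ONLY … THEN the chart socket on the INNER transport with `(Ψ_in, J_in)`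
depending on `U_out`».  Sibling abstract layer (localised, continuous-version ∕ `regSet` door): dag-n09-w6's `Node00/RegSetOfFibredChart` (p609712).

WHY (print, [III] pp. 267–270; [I] §2).  One renormalization step integrates the level-`k` bond variables in THREE groups: (out) the bonds over
`Ω^c_{k+1}` — group-valued, NOT charted, conditionally transported (11a's `vOp` ∕ `kernelRTOfRecord`); (in) the bonds over `Ω_{k+1}` — charted by
`A_k = (1∕i) log V′_k`, linearised and `C`-parametrised, of which (in-kept) those over `Ω_{k+1} ∩ Λ^c_{k+1}` are RETAINED in `𝐓^{(k)}` and (in-int)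
those over `Λ_{k+1}` are INTEGRATED against the conditional Gaussian (3.23).  def-T's transport of record `transportOfRecord = kernelTransport
(fieldMeasure k) (fieldMeasure (k+1)) avOfRecord` integrates ALL level-`k` variables at once; for the two sides of the 𝐓-image clause (O3′) to meet
by 11a's `tkBranchOfRecord_succ` the transport must first be SEPARATED into «outside variables by the plain transport, fibrewise in the
rest-variable; inside variables through their chart, with the outside field as a parameter».  THIS FILE is that separation for the ABSTRACT kernel
transport of `T4AveragingDisintegration`; the inner chart identity itself (dag-n11-d's theorem) enters only as the displayed hypothesis `hin` of §4.

WHAT THIS FILE PROVES (generic measurable spaces; `ν`'s finite, reference measures σ-finite ∕ finite as stated; 0 `def`, 0 `sorry`).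
* §1 TRANSITIVITY THROUGH AN INTERMEDIATE REFERENCE — `absolutelyContinuous_map_comp_of_map_map`; ★ `kernelTransport_congr_ae` (a.e.-equal
  integrable densities have a.e.-equal transports); ★★ `kernelTransport_comp_ae_eq`: for `avg₁ : β → γ`, `avg₂ : γ → α`, `ν.map avg₁ ≪ ξ`,
  `ξ.map avg₂ ≪ μ` and `ρ` integrable, `kernelTransport ν μ (avg₂ ∘ avg₁) ρ =ᵐ[μ] kernelTransport ξ μ avg₂ (kernelTransport ν ξ avg₁ ρ)` (the push-forward
  identity `integral_kernelTransport_mul` twice + a.e. uniqueness `ae_eq_of_forall_integral_mul_eq`).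
* §2 THE OUTSIDE FACTOR, THE REST-VARIABLE CARRIED AS A PARAMETER — `map_prodMap_id_absolutelyContinuous`; ★★ `kernelTransport_prodMap_id_ae_eq`: for
  `ξ = ν_out ⊗ μ_r`, `μ = μ_out ⊗ μ_r`, `ν_out.map avg_out ≪ μ_out` and `g` measurable and `ξ`-integrable,
  `kernelTransport ξ μ (Prod.map avg_out id) g =ᵐ[μ] (V, r) ↦ kernelTransport ν_out μ_out avg_out (g (·, r)) V` (Fubini on both sides + the push-forward
  identity fibrewise in `r` + a.e. uniqueness; joint measurability of the right-hand side is dag-n11-d's `measurable_kernelTransport_param`).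
* §3 THE INSIDE SOCKET OF A SKEW PRODUCT, KERNEL-FREE — ★★ `map_withDensity_skewChart_eq_restrict` + `ae_avgRest_skewChart_eq`: a `U_out`-PARAMETRISED
  family of inside charts `Ψ_in (U_out, (r, x))`, Jacobians `J (U_out, (r, x))`, fibre reference `τ`, charted set `S ⊆ B × D`, with the fibrewise
  identities `hpush_in` ∕ `hfib_in` for `ν_out`-a.e. `U_out`, ASSEMBLES to ONE chart `((U_out, r), x) ↦ (U_out, Ψ_in (U_out, (r, x)))` of the product
  fine space satisfying dag-n11-d's socket verbatim for `(ν := ν_out ⊗ ν_in, μ := ν_out ⊗ μ_r, avg₁ := U ↦ (U.1, avg_rest U))` (Tonelli only).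
* §4 ASSEMBLY — ★★★ `kernelTransport_skewProduct_ae_eq`: for `avg U = (avg_out U.1, avg_rest U) = Prod.map avg_out id ∘ avg₁`, under
  `ν_out.map avg_out ≪ μ_out`, `(ν_out ⊗ ν_in).map avg₁ ≪ ν_out ⊗ μ_r` and the DISPLAYED inner reading `hin : kernelTransport (ν_out ⊗ ν_in) (ν_out ⊗ μ_r)
  avg₁ ρ =ᵐ F` (dag-n11-d's ★★★ at §3's chart the day it lands; any other inner reading serves as well):
  `kernelTransport (ν_out ⊗ ν_in) (μ_out ⊗ μ_r) avg ρ =ᵐ[μ_out ⊗ μ_r] (V_out, r) ↦ kernelTransport ν_out μ_out avg_out (F (·, r)) V_out` — dag-n11-e's display,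
  with `F (U_out, r) = ∫ J (U_out,(r,x)) · ρ (U_out, Ψ_in (U_out,(r,x))) dτ(x)` in the chart reading (`kernelTransport_skewProduct_ae_eq_chartReading`).

NOT IN THIS FILE: any chart, Jacobian or Haar-in-coordinates computation; the inner chart identity (dag-n11-d's `…N11KernelTransportInFibreChart`);
the (0.4) window ∕ locality writing `avOfRecord` as a skew product over a bond partition (dag-n11-e's `Node00/AveragingTwoBlockWindow` + node00-def-T's
CHECK-1 ruling); the identification of the outside factor with 11a's `vOp` ∕ `kernelRTOfRecord` (def-T's swap face; itself an `=ᵐ` statement).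

HONEST FRAMING.  Helper lane of K1⁷, count-neutral; [folklore] measure theory (Fubini ∕ Tonelli, push-forward, `withDensity`, a.e. uniqueness of the
transform) over def-T's DEFINITIONS `jointLaw ∕ condLaw ∕ margDensity ∕ kernelTransport`; nothing of Bałaban's ([I] §2, [III] §3, [16] Sect. C) is
asserted; (B4) ∕ (S-α) NOT closed; no registered stub proved; N11 NOT discharged; K1⁷ NOT closed; counts unmoved (typed 28∕28 · discharged 5∕27).  One
finite four-torus programme at fixed `ε = L^{−K}`; R4 closes only the conditional finite-𝕋⁴ rung `BalabanLadder.UV` — NOT ℝ⁴, NOT OS, NOT a mass gap,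
NOT Clay.  No `sorry`, `axiom`, `def`, `instance`, `notation`.  Sources (SHAPE only): [III] (2.20)–(2.21) p.258, (3.1) p.264, pp.267–270; [I] (0.13) p.254.
-/

noncomputable section

open MeasureTheory ProbabilityTheory Set Filter
open scoped ENNReal NNReal

namespace Summit.QuantumFields.YangMills.Theorems.BalabanUVNodesN11KernelTransportSkewProduct

open Literature.MathematicalPhysics.QuantumFieldTheory.Balaban1983to89
open T4AveragingDisintegration (kernelTransport margDensity condLaw integral_kernelTransport_mul integrable_kernelTransport
  ae_eq_of_forall_integral_mul_eq kernelTransport_nonneg)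
open BalabanUVNodesN11TkOpMeasurable (measurable_kernelTransport_param measurable_kernelTransport)

/-! ## §1  Transitivity of the kernel transport through an intermediate reference measure -/

section Transitivity

variable {α β γ : Type*} [MeasurableSpace α] [MeasurableSpace β] [MeasurableSpace γ]

/-- Absolute continuity of the composite push-forward: `ν.map avg₁ ≪ ξ` and `ξ.map avg₂ ≪ μ` give `ν.map (avg₂ ∘ avg₁) ≪ μ`
(push absolute continuity forward along `avg₂`, then compose). -/
theorem absolutelyContinuous_map_comp_of_map_map (ν : Measure β) (ξ : Measure γ) (μ : Measure α) {avg₁ : β → γ} {avg₂ : γ → α}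
    (h₁ : Measurable avg₁) (h₂ : Measurable avg₂) (hac₁ : ν.map avg₁ ≪ ξ) (hac₂ : ξ.map avg₂ ≪ μ) :
    ν.map (avg₂ ∘ avg₁) ≪ μ := by
  rw [← Measure.map_map h₂ h₁]
  exact (hac₁.map h₂).trans hac₂

variable [StandardBorelSpace β] [Nonempty β]

/-- **CONGRUENCE**: two `ν`-a.e. equal integrable densities have `μ`-a.e. equal kernel transports (both transports are `μ`-integrable and have the
same integrals against every bounded measurable test by the push-forward identity; a.e. uniqueness). -/
theorem kernelTransport_congr_ae (ν : Measure β) [IsFiniteMeasure ν] (μ : Measure α) [SigmaFinite μ] {avg : β → α}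
    (havg : Measurable avg) (hac : ν.map avg ≪ μ) {ρ ρ' : β → ℝ} (hρ : Integrable ρ ν) (h : ρ =ᵐ[ν] ρ') :
    kernelTransport ν μ avg ρ =ᵐ[μ] kernelTransport ν μ avg ρ' := by
  have hρ' : Integrable ρ' ν := hρ.congr h
  refine ae_eq_of_forall_integral_mul_eq (integrable_kernelTransport ν μ havg hac hρ)
    (integrable_kernelTransport ν μ havg hac hρ') fun f hf hC => ?_
  obtain ⟨C, hC⟩ := hC
  rw [integral_kernelTransport_mul ν μ havg hac hρ hf hC, integral_kernelTransport_mul ν μ havg hac hρ' hf hC]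
  exact integral_congr_ae (h.mono fun U hU => by simp only [hU])

variable [StandardBorelSpace γ] [Nonempty γ]

/-- ★★ **TRANSITIVITY OF THE KERNEL TRANSPORT THROUGH AN INTERMEDIATE REFERENCE.**  For measurable `avg₁ : β → γ`, `avg₂ : γ → α`, a finite
fine measure `ν`, a finite intermediate reference `ξ` with `ν.map avg₁ ≪ ξ`, a σ-finite coarse reference `μ` with `ξ.map avg₂ ≪ μ`, and an
integrable density `ρ`: transporting along the composite `avg₂ ∘ avg₁` IS transporting along `avg₁` (to a `ξ`-density) and then along `avg₂` —
`kernelTransport ν μ (avg₂ ∘ avg₁) ρ =ᵐ[μ] kernelTransport ξ μ avg₂ (kernelTransport ν ξ avg₁ ρ)` (push-forward identity twice, a.e. uniqueness). -/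
theorem kernelTransport_comp_ae_eq (ν : Measure β) [IsFiniteMeasure ν] (ξ : Measure γ) [IsFiniteMeasure ξ] (μ : Measure α) [SigmaFinite μ]
    {avg₁ : β → γ} {avg₂ : γ → α} (h₁ : Measurable avg₁) (h₂ : Measurable avg₂)
    (hac₁ : ν.map avg₁ ≪ ξ) (hac₂ : ξ.map avg₂ ≪ μ) {ρ : β → ℝ} (hρ : Integrable ρ ν) :
    kernelTransport ν μ (avg₂ ∘ avg₁) ρ =ᵐ[μ] kernelTransport ξ μ avg₂ (kernelTransport ν ξ avg₁ ρ) := by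
  have hac := absolutelyContinuous_map_comp_of_map_map ν ξ μ h₁ h₂ hac₁ hac₂
  have hT₁ : Integrable (kernelTransport ν ξ avg₁ ρ) ξ := integrable_kernelTransport ν ξ h₁ hac₁ hρ
  refine ae_eq_of_forall_integral_mul_eq (integrable_kernelTransport ν μ (h₂.comp h₁) hac hρ)
    (integrable_kernelTransport ξ μ h₂ hac₂ hT₁) fun f hf hC => ?_
  obtain ⟨C, hC⟩ := hC
  rw [integral_kernelTransport_mul ν μ (h₂.comp h₁) hac hρ hf hC, integral_kernelTransport_mul ξ μ h₂ hac₂ hT₁ hf hC]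
  exact (integral_kernelTransport_mul ν ξ h₁ hac₁ hρ (hf.comp h₂) (fun W => hC (avg₂ W))).symm

end Transitivity

/-! ## §2  The outside factor of a product: the rest-variable is carried along as a parameter -/

section Outside

variable {A B R : Type*} [MeasurableSpace A] [MeasurableSpace B] [MeasurableSpace R]

/-- Absolute continuity of the outside averaging survives the product with an untouched rest-factor:
`(ν_out ⊗ μ_r).map (Prod.map avg_out id) = (ν_out.map avg_out) ⊗ μ_r ≪ μ_out ⊗ μ_r`. -/
theorem map_prodMap_id_absolutelyContinuous (ν_out : Measure B) [SFinite ν_out] (μ_out : Measure A) (μ_r : Measure R) [SFinite μ_r]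
    {avg_out : B → A} (havg : Measurable avg_out) (hac : ν_out.map avg_out ≪ μ_out) :
    (ν_out.prod μ_r).map (Prod.map avg_out id) ≪ μ_out.prod μ_r := by
  rw [← Measure.map_prod_map ν_out μ_r havg measurable_id, Measure.map_id]
  exact hac.prod Measure.AbsolutelyContinuous.rfl

variable [StandardBorelSpace B] [Nonempty B] [StandardBorelSpace R] [Nonempty R]

/-- ★★ **THE OUTSIDE FACTOR WITH THE REST-VARIABLE AS A PARAMETER.**  Fine measure `ξ = ν_out ⊗ μ_r` on `B × R`, coarse reference
`μ = μ_out ⊗ μ_r` on `A × R`, averaging `Prod.map avg_out id` (the outside variable is averaged, the rest-variable is carried along), `ν_out.map avg_out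
≪ μ_out`, `g` measurable and `ξ`-integrable.  Then the kernel transport of the pair IS, fibrewise in the rest-variable, the plain outside transport of the
section: `kernelTransport ξ μ (Prod.map avg_out id) g =ᵐ[μ] (V, r) ↦ kernelTransport ν_out μ_out avg_out (g (·, r)) V`.  (Right-hand side jointly
measurable by `measurable_kernelTransport_param`; integrable by Fubini and `|∫ g dκ| ≤ ∫ |g| dκ`; same integrals against bounded measurable tests by
Fubini on both sides and the push-forward identity fibrewise in `r`; a.e. uniqueness.) -/
theorem kernelTransport_prodMap_id_ae_eq (ν_out : Measure B) [IsFiniteMeasure ν_out] (μ_out : Measure A) [SigmaFinite μ_out]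
    (μ_r : Measure R) [IsFiniteMeasure μ_r] {avg_out : B → A} (havg : Measurable avg_out) (hac : ν_out.map avg_out ≪ μ_out)
    {g : B × R → ℝ} (hgm : Measurable g) (hg : Integrable g (ν_out.prod μ_r)) :
    kernelTransport (ν_out.prod μ_r) (μ_out.prod μ_r) (Prod.map avg_out id) g
      =ᵐ[μ_out.prod μ_r] fun p => kernelTransport ν_out μ_out avg_out (fun u => g (u, p.2)) p.1 := by
  -- notation: `T r := kernelTransport ν_out μ_out avg_out (g (·, r))`, `Tabs r := kernelTransport ν_out μ_out avg_out (|g (·, r)|)`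
  set Φ : A × R → ℝ := fun p => kernelTransport ν_out μ_out avg_out (fun u => g (u, p.2)) p.1 with hΦ
  have hacP := map_prodMap_id_absolutelyContinuous ν_out μ_out μ_r havg hac
  have hPm : Measurable (Prod.map avg_out (id : R → R)) := havg.prodMap measurable_id
  -- joint measurability of the right-hand side and of its absolute majorant
  have hΦm : Measurable Φ := by
    have h := measurable_kernelTransport_param (γ := R) ν_out μ_out avg_out (f := fun z : R × B => g (z.2, z.1))
      (hgm.comp (measurable_snd.prodMk measurable_fst))
    exact h.comp (measurable_snd.prodMk measurable_fst)
  have hgabs : Measurable fun q : B × R => |g q| := hgm.abs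
  set Φa : A × R → ℝ := fun p => kernelTransport ν_out μ_out avg_out (fun u => |g (u, p.2)|) p.1 with hΦa
  have hΦam : Measurable Φa := by
    have h := measurable_kernelTransport_param (γ := R) ν_out μ_out avg_out (f := fun z : R × B => |g (z.2, z.1)|)
      (hgabs.comp (measurable_snd.prodMk measurable_fst))
    exact h.comp (measurable_snd.prodMk measurable_fst)
  -- pointwise domination `|Φ| ≤ Φa`
  have hdom : ∀ p, ‖Φ p‖ ≤ Φa p := fun p => by
    simp only [hΦ, hΦa, kernelTransport, Real.norm_eq_abs, abs_mul, NNReal.abs_eq]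
    gcongr
    exact abs_integral_le_integral_abs
  -- sections: for `μ_r`-a.e. `r` the section `g (·, r)` is `ν_out`-integrable
  have hsec : ∀ᵐ r ∂μ_r, Integrable (fun u => g (u, r)) ν_out := hg.prod_left_ae
  -- integrability of `Φa` (hence of `Φ`) on `μ_out ⊗ μ_r` via `integrable_prod_iff'`
  have hΦa_int : Integrable Φa (μ_out.prod μ_r) := by
    rw [integrable_prod_iff' hΦam.aestronglyMeasurable]
    refine ⟨?_, ?_⟩
    · filter_upwards [hsec] with r hr
      exact integrable_kernelTransport ν_out μ_out havg hac hr.abs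
    · have hnorm : Integrable (fun r => ∫ u, ‖g (u, r)‖ ∂ν_out) μ_r := hg.integral_norm_prod_right
      refine hnorm.mono' (hΦam.norm.stronglyMeasurable.integral_prod_left').aestronglyMeasurable ?_
      filter_upwards [hsec] with r hr
      have hTa : Integrable (fun a => Φa (a, r)) μ_out := integrable_kernelTransport ν_out μ_out havg hac hr.abs
      have h0 : ∀ a, 0 ≤ Φa (a, r) := fun a => kernelTransport_nonneg (fun u => abs_nonneg _) a
      rw [Real.norm_eq_abs, abs_of_nonneg (integral_nonneg fun a => norm_nonneg _)]
      calc ∫ a, ‖Φa (a, r)‖ ∂μ_out = ∫ a, Φa (a, r) * (fun _ : A => (1 : ℝ)) a ∂μ_out := by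
            refine integral_congr_ae (ae_of_all _ fun a => ?_)
            simp only [Real.norm_eq_abs, abs_of_nonneg (h0 a), mul_one]
        _ = ∫ u, |g (u, r)| * (fun _ : A => (1 : ℝ)) (avg_out u) ∂ν_out :=
            integral_kernelTransport_mul ν_out μ_out havg hac hr.abs measurable_const (C := 1) (fun _ => by simp)
        _ = ∫ u, ‖g (u, r)‖ ∂ν_out := integral_congr_ae (ae_of_all _ fun u => by simp [Real.norm_eq_abs])
        _ ≤ ∫ u, ‖g (u, r)‖ ∂ν_out := le_rfl
  have hΦ_int : Integrable Φ (μ_out.prod μ_r) :=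
    hΦa_int.mono' hΦm.aestronglyMeasurable (ae_of_all _ hdom)
  -- the test identity
  refine ae_eq_of_forall_integral_mul_eq (integrable_kernelTransport _ _ hPm hacP hg) hΦ_int fun f hf hC => ?_
  obtain ⟨C, hC⟩ := hC
  rw [integral_kernelTransport_mul _ _ hPm hacP hg hf hC]
  -- right-hand side: Fubini, fibrewise push-forward identity, Fubini back
  have hfb : ∀ p, ‖f p‖ ≤ C := fun p => by simpa [Real.norm_eq_abs] using hC p
  have hΦf : Integrable (fun p => Φ p * f p) (μ_out.prod μ_r) :=
    hΦ_int.mul_bdd hf.aestronglyMeasurable (Eventually.of_forall hfb)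
  have hgf : Integrable (fun q : B × R => g q * f (Prod.map avg_out id q)) (ν_out.prod μ_r) :=
    hg.mul_bdd (hf.comp hPm).aestronglyMeasurable (Eventually.of_forall fun q => hfb _)
  rw [integral_prod_symm _ hgf, integral_prod_symm _ hΦf]
  refine integral_congr_ae ?_
  filter_upwards [hsec] with r hr
  have hfr : Measurable fun a : A => f (a, r) := hf.comp (measurable_id.prodMk measurable_const)
  have key := integral_kernelTransport_mul ν_out μ_out havg hac hr hfr (C := C) (fun a => hC (a, r))
  simpa only [hΦ, Prod.map_apply, id_eq] using key.symm

end Outside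

/-! ## §3  The inside socket of a skew product, kernel-free: fibrewise inside charts assemble to one chart of the product -/

section InsideSocket

variable {B D R X : Type*} [MeasurableSpace B] [MeasurableSpace D] [MeasurableSpace R] [MeasurableSpace X]

/-- The assembled chart `((U_out, r), x) ↦ (U_out, Ψ_in (U_out, (r, x)))` of the product fine space is measurable. -/
theorem measurable_skewChart {Ψ_in : B × (R × X) → D} (hΨ : Measurable Ψ_in) :
    Measurable fun z : (B × R) × X => (z.1.1, Ψ_in (z.1.1, (z.1.2, z.2))) :=
  measurable_fst.fst.prodMk (hΨ.comp (measurable_fst.fst.prodMk (measurable_fst.snd.prodMk measurable_snd)))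

/-- The assembled Jacobian `((U_out, r), x) ↦ J (U_out, (r, x))` is measurable. -/
theorem measurable_skewJacobian {J : B × (R × X) → ℝ≥0∞} (hJ : Measurable J) :
    Measurable fun z : (B × R) × X => J (z.1.1, (z.1.2, z.2)) :=
  hJ.comp (measurable_fst.fst.prodMk (measurable_fst.snd.prodMk measurable_snd))

/-- ★★ **FIBREWISE INSIDE CHARTS ASSEMBLE — the push-forward identity.**  Outside fine measure `ν_out` on `B`, inside fine measure `ν_in` on `D`,
rest-reference `μ_r` on `R`, fibre reference `τ` on `X` (all s-finite); a jointly measurable family of inside charts `Ψ_in (U_out, (r, x)) : D` with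
Jacobians `J (U_out, (r, x))` and a measurable charted set `S ⊆ B × D`, such that for `ν_out`-almost every outside configuration `U_out` the inside
chart pushes the weighted product reference onto the inside measure restricted to the section of `S`:
`((μ_r ⊗ τ)·J(U_out, ·)).map (Ψ_in (U_out, ·)) = ν_in⌊(S_{U_out})`.  THEN the assembled chart of the PRODUCT fine space satisfies dag-n11-d's socket
hypothesis `hpush` verbatim for the inner averaging step (fine measure `ν_out ⊗ ν_in`, coarse reference `ν_out ⊗ μ_r`, fibre reference `τ`):
`(((ν_out ⊗ μ_r) ⊗ τ)·J₁).map Ψ₁ = (ν_out ⊗ ν_in)⌊S` (Tonelli on both sides, the fibrewise identity in between). -/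
theorem map_withDensity_skewChart_eq_restrict (ν_out : Measure B) [SFinite ν_out] (ν_in : Measure D) [SFinite ν_in]
    (μ_r : Measure R) [SFinite μ_r] (τ : Measure X) [SFinite τ]
    {Ψ_in : B × (R × X) → D} (hΨ : Measurable Ψ_in) {J : B × (R × X) → ℝ≥0∞} (hJ : Measurable J)
    {S : Set (B × D)} (hS : MeasurableSet S)
    (hpush_in : ∀ᵐ u ∂ν_out,
      ((μ_r.prod τ).withDensity (fun z => J (u, z))).map (fun z => Ψ_in (u, z)) = ν_in.restrict (Prod.mk u ⁻¹' S)) :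
    (((ν_out.prod μ_r).prod τ).withDensity (fun z => J (z.1.1, (z.1.2, z.2)))).map
        (fun z => (z.1.1, Ψ_in (z.1.1, (z.1.2, z.2)))) = (ν_out.prod ν_in).restrict S := by
  have hΨ₁ := measurable_skewChart (R := R) hΨ
  have hJ₁ := measurable_skewJacobian (B := B) (R := R) hJ
  refine Measure.ext_of_lintegral _ fun φ hφ => ?_
  -- the integrand of the left-hand side on the triple product
  have hG : Measurable fun z : (B × R) × X => J (z.1.1, (z.1.2, z.2)) * φ (z.1.1, Ψ_in (z.1.1, (z.1.2, z.2))) :=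
    hJ₁.mul (hφ.comp hΨ₁)
  have hGq : Measurable fun q : B × R => ∫⁻ x, J (q.1, (q.2, x)) * φ (q.1, Ψ_in (q.1, (q.2, x))) ∂τ :=
    hG.lintegral_prod_right'
  calc ∫⁻ p, φ p ∂(((ν_out.prod μ_r).prod τ).withDensity (fun z => J (z.1.1, (z.1.2, z.2)))).map
          (fun z => (z.1.1, Ψ_in (z.1.1, (z.1.2, z.2))))
      = ∫⁻ z, J (z.1.1, (z.1.2, z.2)) * φ (z.1.1, Ψ_in (z.1.1, (z.1.2, z.2))) ∂((ν_out.prod μ_r).prod τ) := by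
        rw [lintegral_map hφ hΨ₁]
        exact lintegral_withDensity_eq_lintegral_mul _ hJ₁ (hφ.comp hΨ₁)
    _ = ∫⁻ q, ∫⁻ x, J (q.1, (q.2, x)) * φ (q.1, Ψ_in (q.1, (q.2, x))) ∂τ ∂(ν_out.prod μ_r) :=
        lintegral_prod _ hG.aemeasurable
    _ = ∫⁻ u, ∫⁻ r, ∫⁻ x, J (u, (r, x)) * φ (u, Ψ_in (u, (r, x))) ∂τ ∂μ_r ∂ν_out := lintegral_prod _ hGq.aemeasurable
    _ = ∫⁻ u, ∫⁻ w, S.indicator φ (u, w) ∂ν_in ∂ν_out := by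
        refine lintegral_congr_ae ?_
        filter_upwards [hpush_in] with u hu
        have hJu : Measurable fun z : R × X => J (u, z) := hJ.comp measurable_prodMk_left
        have hΨu : Measurable fun z : R × X => Ψ_in (u, z) := hΨ.comp measurable_prodMk_left
        have hφu : Measurable fun w : D => φ (u, w) := hφ.comp measurable_prodMk_left
        calc ∫⁻ r, ∫⁻ x, J (u, (r, x)) * φ (u, Ψ_in (u, (r, x))) ∂τ ∂μ_r
            = ∫⁻ z, J (u, z) * φ (u, Ψ_in (u, z)) ∂(μ_r.prod τ) :=
              (lintegral_prod _ (hJu.mul (hφu.comp hΨu)).aemeasurable).symm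
          _ = ∫⁻ z, φ (u, Ψ_in (u, z)) ∂((μ_r.prod τ).withDensity fun z => J (u, z)) :=
              (lintegral_withDensity_eq_lintegral_mul _ hJu (hφu.comp hΨu)).symm
          _ = ∫⁻ w, φ (u, w) ∂(((μ_r.prod τ).withDensity fun z => J (u, z)).map fun z => Ψ_in (u, z)) :=
              (lintegral_map hφu hΨu).symm
          _ = ∫⁻ w, φ (u, w) ∂(ν_in.restrict (Prod.mk u ⁻¹' S)) := by rw [hu]
          _ = ∫⁻ w, S.indicator φ (u, w) ∂ν_in := by
              rw [← lintegral_indicator (measurable_prodMk_left hS)]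
              refine lintegral_congr_ae (ae_of_all _ fun w => ?_)
              exact (Set.indicator_comp_right (Prod.mk u) (g := φ) (x := w))
    _ = ∫⁻ p, S.indicator φ p ∂(ν_out.prod ν_in) := (lintegral_prod _ (hφ.indicator hS).aemeasurable).symm
    _ = ∫⁻ p, φ p ∂(ν_out.prod ν_in).restrict S := lintegral_indicator hS _

/-- ★★ **FIBREWISE INSIDE CHARTS ASSEMBLE — the fibre identity.**  If, for `ν_out`-almost every outside configuration `U_out`, the inside chart
lands in the right fibre of the rest-averaging for almost every weighted fibre coordinate — `avg_rest (U_out, Ψ_in (U_out, (r, x))) = r` for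
`((μ_r ⊗ τ)·J(U_out, ·))`-a.e. `(r, x)` — then the assembled chart satisfies dag-n11-d's socket hypothesis `hfib` verbatim for the inner averaging
`avg₁ U = (U.1, avg_rest U)`: `avg₁ (Ψ₁ z) = z.1` for `(((ν_out ⊗ μ_r) ⊗ τ)·J₁)`-a.e. `z` (the measurability of the exceptional set is where
`MeasurableEq R` enters; Mathlib `ae_withDensity_iff`, `Measure.ae_prod_iff_ae_ae`, `measurable_measure_prodMk_left`). -/
theorem ae_avgRest_skewChart_eq (ν_out : Measure B) [SFinite ν_out] (μ_r : Measure R) [SFinite μ_r] (τ : Measure X) [SFinite τ]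
    [MeasurableEq R] {avg_rest : B × D → R} (havg : Measurable avg_rest)
    {Ψ_in : B × (R × X) → D} (hΨ : Measurable Ψ_in) {J : B × (R × X) → ℝ≥0∞} (hJ : Measurable J)
    (hfib_in : ∀ᵐ u ∂ν_out,
      ∀ᵐ z ∂((μ_r.prod τ).withDensity (fun z => J (u, z))), avg_rest (u, Ψ_in (u, z)) = z.1) :
    ∀ᵐ z ∂(((ν_out.prod μ_r).prod τ).withDensity (fun z => J (z.1.1, (z.1.2, z.2)))),
      ((z.1.1, Ψ_in (z.1.1, (z.1.2, z.2))).1, avg_rest (z.1.1, Ψ_in (z.1.1, (z.1.2, z.2)))) = z.1 := by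
  have hΨ₁ := measurable_skewChart (R := R) hΨ
  have hJ₁ := measurable_skewJacobian (B := B) (R := R) hJ
  rw [ae_withDensity_iff hJ₁]
  -- the property and the measurability of its carrier
  set p : (B × R) × X → Prop := fun z =>
    J (z.1.1, (z.1.2, z.2)) ≠ 0 → avg_rest (z.1.1, Ψ_in (z.1.1, (z.1.2, z.2))) = z.1.2 with hp
  have hpset : MeasurableSet {z | p z} := by
    have h0 : MeasurableSet {z : (B × R) × X | J (z.1.1, (z.1.2, z.2)) = 0} := hJ₁ (measurableSet_singleton 0)
    have h1 : MeasurableSet {z : (B × R) × X | avg_rest (z.1.1, Ψ_in (z.1.1, (z.1.2, z.2))) = z.1.2} :=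
      measurableSet_eq_fun (havg.comp hΨ₁) measurable_fst.snd
    have e : {z | p z} = {z : (B × R) × X | J (z.1.1, (z.1.2, z.2)) = 0} ∪
        {z | avg_rest (z.1.1, Ψ_in (z.1.1, (z.1.2, z.2))) = z.1.2} := by
      ext z
      simp only [hp, mem_setOf_eq, mem_union, ne_eq]
      tauto
    rw [e]
    exact h0.union h1
  have hpset2 : MeasurableSet {q : B × R | ∀ᵐ x ∂τ, p (q, x)} := by
    have hm := measurable_measure_prodMk_left (ν := τ) hpset.compl
    have e : {q : B × R | ∀ᵐ x ∂τ, p (q, x)} = (fun q : B × R => τ (Prod.mk q ⁻¹' {z | p z}ᶜ)) ⁻¹' {0} := by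
      ext q
      simp only [mem_setOf_eq, ae_iff, mem_preimage, mem_singleton_iff]
      rfl
    rw [e]
    exact hm (measurableSet_singleton 0)
  -- reduce the pair identity to its rest-component and split the product a.e. twice
  have goal : ∀ᵐ z ∂((ν_out.prod μ_r).prod τ), p z := by
    rw [Measure.ae_prod_iff_ae_ae hpset, Measure.ae_prod_iff_ae_ae hpset2]
    filter_upwards [hfib_in] with u hu
    have hJu : Measurable fun z : R × X => J (u, z) := hJ.comp measurable_prodMk_left
    rw [ae_withDensity_iff hJu] at hu
    have hu' := Measure.ae_ae_of_ae_prod hu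
    filter_upwards [hu'] with r hr
    filter_upwards [hr] with x hx
    simpa only [hp] using hx
  filter_upwards [goal] with z hz hJz
  exact Prod.ext rfl (hz hJz)

end InsideSocket

/-! ## §4  Assembly: the skew-product chain rule (inner reading displayed) -/

section Assembly

variable {A B D R X : Type*} [MeasurableSpace A] [MeasurableSpace B] [MeasurableSpace D] [MeasurableSpace R] [MeasurableSpace X]
  [StandardBorelSpace B] [Nonempty B] [StandardBorelSpace D] [Nonempty D] [StandardBorelSpace R] [Nonempty R]

/-- ★★★ **THE SKEW-PRODUCT CHAIN RULE FOR THE KERNEL TRANSPORT.**  Fine measure `ν_out ⊗ ν_in` on `B × D` (outside × inside variables), coarse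
reference `μ_out ⊗ μ_r` on `A × R`, skew averaging `avg U = (avg_out U.1, avg_rest U)` (the outside coarse variables read the outside fine variables
ONLY; the rest may read everything), `ν_out.map avg_out ≪ μ_out`, the inner step `avg₁ U = (U.1, avg_rest U)` absolutely continuous onto the
intermediate reference `ν_out ⊗ μ_r`, `ρ` integrable, and the DISPLAYED inner reading `hin`: the transport along the inner step is a.e. the measurable
function `F` (dag-n11-d's fibre-chart identity at §3's assembled chart gives `F (U_out, r) = ∫ J · ρ ∘ Ψ_in dτ`; any other inner reading serves).  THEN
`kernelTransport (ν_out ⊗ ν_in) (μ_out ⊗ μ_r) avg ρ =ᵐ[μ_out ⊗ μ_r] (V_out, r) ↦ kernelTransport ν_out μ_out avg_out (F (·, r)) V_out`: the outside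
variables are transported by the PLAIN outside transport, fibrewise in the rest-variable, applied to the inner reading — dag-n11-e's separation face
(§1 transitivity with `avg = Prod.map avg_out id ∘ avg₁`, §1 congruence along `hin`, §2 on the outside factor). -/
theorem kernelTransport_skewProduct_ae_eq (ν_out : Measure B) [IsFiniteMeasure ν_out] (ν_in : Measure D) [IsFiniteMeasure ν_in]
    (μ_out : Measure A) [SigmaFinite μ_out] (μ_r : Measure R) [IsFiniteMeasure μ_r]
    {avg_out : B → A} (havg_out : Measurable avg_out) {avg_rest : B × D → R} (havg_rest : Measurable avg_rest)
    (hac_out : ν_out.map avg_out ≪ μ_out)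
    (hac_in : (ν_out.prod ν_in).map (fun U => (U.1, avg_rest U)) ≪ ν_out.prod μ_r)
    {ρ : B × D → ℝ} (hρ : Integrable ρ (ν_out.prod ν_in)) {F : B × R → ℝ} (hFm : Measurable F)
    (hin : kernelTransport (ν_out.prod ν_in) (ν_out.prod μ_r) (fun U => (U.1, avg_rest U)) ρ =ᵐ[ν_out.prod μ_r] F) :
    kernelTransport (ν_out.prod ν_in) (μ_out.prod μ_r) (fun U => (avg_out U.1, avg_rest U)) ρ
      =ᵐ[μ_out.prod μ_r] fun p => kernelTransport ν_out μ_out avg_out (fun u => F (u, p.2)) p.1 := by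
  have h₁ : Measurable (fun U : B × D => (U.1, avg_rest U)) := measurable_fst.prodMk havg_rest
  have h₂ : Measurable (Prod.map avg_out (id : R → R)) := havg_out.prodMap measurable_id
  have hac₂ := map_prodMap_id_absolutelyContinuous ν_out μ_out μ_r havg_out hac_out
  have hcomp : (fun U : B × D => (avg_out U.1, avg_rest U)) = Prod.map avg_out id ∘ (fun U => (U.1, avg_rest U)) := rfl
  have hT₁ : Integrable (kernelTransport (ν_out.prod ν_in) (ν_out.prod μ_r) (fun U => (U.1, avg_rest U)) ρ) (ν_out.prod μ_r) :=
    integrable_kernelTransport _ _ h₁ hac_in hρ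
  have hF : Integrable F (ν_out.prod μ_r) := hT₁.congr hin
  rw [hcomp]
  calc kernelTransport (ν_out.prod ν_in) (μ_out.prod μ_r) (Prod.map avg_out id ∘ fun U => (U.1, avg_rest U)) ρ
      =ᵐ[μ_out.prod μ_r] kernelTransport (ν_out.prod μ_r) (μ_out.prod μ_r) (Prod.map avg_out id)
          (kernelTransport (ν_out.prod ν_in) (ν_out.prod μ_r) (fun U => (U.1, avg_rest U)) ρ) :=
        kernelTransport_comp_ae_eq _ _ _ h₁ h₂ hac_in hac₂ hρ
    _ =ᵐ[μ_out.prod μ_r] kernelTransport (ν_out.prod μ_r) (μ_out.prod μ_r) (Prod.map avg_out id) F :=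
        kernelTransport_congr_ae _ _ h₂ hac₂ hT₁ hin
    _ =ᵐ[μ_out.prod μ_r] fun p => kernelTransport ν_out μ_out avg_out (fun u => F (u, p.2)) p.1 :=
        kernelTransport_prodMap_id_ae_eq ν_out μ_out μ_r havg_out hac_out hFm hF

omit [StandardBorelSpace B] [Nonempty B] [StandardBorelSpace D] [Nonempty D] [StandardBorelSpace R] [Nonempty R] in
/-- The fibre integral of the chart reading, `(U_out, r) ↦ ∫ J (U_out,(r,x)) · ρ (U_out, Ψ_in (U_out,(r,x))) dτ(x)`, is jointly measurable
(Mathlib `StronglyMeasurable.integral_prod_right'`). -/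
theorem measurable_integral_skewChartReading (τ : Measure X) [SFinite τ]
    {Ψ_in : B × (R × X) → D} (hΨ : Measurable Ψ_in) {J : B × (R × X) → ℝ≥0∞} (hJ : Measurable J)
    {ρ : B × D → ℝ} (hρm : Measurable ρ) :
    Measurable fun q : B × R => ∫ x, (J (q.1, (q.2, x))).toReal * ρ (q.1, Ψ_in (q.1, (q.2, x))) ∂τ := by
  have hG : Measurable fun z : (B × R) × X => (J (z.1.1, (z.1.2, z.2))).toReal * ρ (z.1.1, Ψ_in (z.1.1, (z.1.2, z.2))) :=
    (measurable_skewJacobian (B := B) (R := R) hJ).ennreal_toReal.mul (hρm.comp (measurable_skewChart (R := R) hΨ))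
  exact (hG.stronglyMeasurable.integral_prod_right' (ν := τ)).measurable

/-- ★★★ **THE SKEW-PRODUCT CHAIN RULE IN THE CHART READING** — dag-n11-e's display: with the inner reading supplied AT §3's ASSEMBLED CHART
(`hin`: the inner transport is a.e. the fibre integral `(U_out, r) ↦ ∫ J (U_out,(r,x)) · ρ (U_out, Ψ_in (U_out,(r,x))) dτ(x)` — exactly the
conclusion of dag-n11-d's `…N11KernelTransportInFibreChart` at the socket `map_withDensity_skewChart_eq_restrict` ∕ `ae_avgRest_skewChart_eq`),
`kernelTransport (ν_out ⊗ ν_in) (μ_out ⊗ μ_r) avg ρ =ᵐ[μ_out ⊗ μ_r]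
  (V_out, r) ↦ kernelTransport ν_out μ_out avg_out [U_out ↦ ∫ J (U_out,(r,x)) · ρ (U_out, Ψ_in (U_out,(r,x))) dτ(x)] V_out`:
outside variables by the plain (un-charted) transport, inside variables through their `U_out`-dependent chart. -/
theorem kernelTransport_skewProduct_ae_eq_chartReading (ν_out : Measure B) [IsFiniteMeasure ν_out] (ν_in : Measure D) [IsFiniteMeasure ν_in]
    (μ_out : Measure A) [SigmaFinite μ_out] (μ_r : Measure R) [IsFiniteMeasure μ_r] (τ : Measure X) [SFinite τ]
    {avg_out : B → A} (havg_out : Measurable avg_out) {avg_rest : B × D → R} (havg_rest : Measurable avg_rest)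
    (hac_out : ν_out.map avg_out ≪ μ_out)
    (hac_in : (ν_out.prod ν_in).map (fun U => (U.1, avg_rest U)) ≪ ν_out.prod μ_r)
    {Ψ_in : B × (R × X) → D} (hΨ : Measurable Ψ_in) {J : B × (R × X) → ℝ≥0∞} (hJ : Measurable J)
    {ρ : B × D → ℝ} (hρm : Measurable ρ) (hρ : Integrable ρ (ν_out.prod ν_in))
    (hin : kernelTransport (ν_out.prod ν_in) (ν_out.prod μ_r) (fun U => (U.1, avg_rest U)) ρ
      =ᵐ[ν_out.prod μ_r] fun q => ∫ x, (J (q.1, (q.2, x))).toReal * ρ (q.1, Ψ_in (q.1, (q.2, x))) ∂τ) :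
    kernelTransport (ν_out.prod ν_in) (μ_out.prod μ_r) (fun U => (avg_out U.1, avg_rest U)) ρ
      =ᵐ[μ_out.prod μ_r] fun p => kernelTransport ν_out μ_out avg_out
        (fun u => ∫ x, (J (u, (p.2, x))).toReal * ρ (u, Ψ_in (u, (p.2, x))) ∂τ) p.1 :=
  kernelTransport_skewProduct_ae_eq ν_out ν_in μ_out μ_r havg_out havg_rest hac_out hac_in hρ
    (measurable_integral_skewChartReading τ hΨ hJ hρm) hin

end Assembly

end Summit.QuantumFields.YangMills.Theorems.BalabanUVNodesN11KernelTransportSkewProduct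
end
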